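import Mathlib
import Summits.Schanuel.Schanuel.Theorems.AclSubsetLogFreeCore.Negative.ExpAclDefinability

/-!
# Crux `AclSubsetLogFreeCore` — tightness: `acl^{ℂ_exp}(∅)` is an `exp`-closed relatively algebraically closed field ∋ `2πi`, so `C_EA ⊆ acl(∅)`

Theorems for the crux (A) `RigidCore.AclSubsetLogFreeCore` (stmt-Schanuel-0968), all proved
(Marker, *Model Theory* §1.3 / Ex. 1.4.10 folklore about `acl`, specialised to `ℂ_exp` over
Mathlib's `Set.Definable`):

* `acl(∅)` is closed under `exp`, `+`, `·`, `−`, `⁻¹` and contains `ℤ` (`exp_mem_expAcl`, …),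
  packaged as `expAclSubfield : Subfield ℂ` / `expAclField : IntermediateField ℚ ℂ`;
* `expAcl_relAlgClosed`: `acl(∅)` is relatively algebraically closed in `ℂ` (a root of a non-zero
  polynomial with coefficients in finite `∅`-definable sets lies in the finite `∅`-definable set of
  roots of the non-degenerate polynomials with coefficients from those sets; integer polynomial
  maps in any finite set of variables are definable, `definableFun_mvPolynomial_aeval'`);
* hence `expAclField ∈ coreFamily` and **`logFreeCore_subset_expAcl : C_EA ⊆ acl(∅)`** — this is
  the route's support item `RigidCore.LogFreeCoreSubsetAcl` (stmt-Schanuel-0972) up to unfolding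
  (a prover closes that item by the one-liner `fun _ ha => logFreeCore_subset_expAcl ha`);
* TIGHTNESS of the crux: `aclSubsetLogFreeCore_iff_eq : (A) ⟺ acl(∅) = C_EA` — the bound `C_EA`
  in (A) cannot be improved.

## References

* [Marker2002] D. Marker, *Model Theory: An Introduction*, Springer GTM 217, §1.3, Lemma 1.3.? /
  Exercise 1.4.10–1.4.11 (`acl(A)` is an algebraically closed substructure: closed under definable
  functions; roots of polynomials over `acl` are in `acl`).
* [KirbyMacintyreOnshuus2012] J. Kirby, A. Macintyre, A. Onshuus, arXiv:1101.4224, §2 (`ℤ`,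
  `±2πi` parameter-free definable, so `2πi ∈ acl(∅)`).
-/

noncomputable section

open FirstOrder FirstOrder.Language Set
open Literature.ModelTheory.ExponentialFields

namespace Summit.Schanuel.Schanuel.Theorems.AclSubsetLogFreeCore.Negative

variable {α : Type*} {A : Set ℂ}

/-- A pointwise `∅`-definable constant is in `acl(∅)`. -/
theorem mem_expAcl_of_definableFun_const {a : ℂ}
    (h : (∅ : Set ℂ).DefinableFun Language.expRing (fun _ : Fin 1 → ℂ => a)) : a ∈ expAcl := by
  refine ⟨{a}, Set.finite_singleton a, ?_, rfl⟩
  have hd := definable_setOf_eq_params (definableFun_proj_params (A := (∅ : Set ℂ)) (α := Fin 1) 0) h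
  have e : {x : Fin 1 → ℂ | x 0 ∈ ({a} : Set ℂ)} = {v : Fin 1 → ℂ | v 0 = a} := by ext v; simp
  show Set.Definable₁ _ _ _
  unfold Set.Definable₁; rw [e]; exact hd

/-- `ℕ ⊆ acl(∅)`. [folklore] -/
theorem natCast_mem_expAcl (n : ℕ) : (n : ℂ) ∈ expAcl :=
  mem_expAcl_of_definableFun_const (definableFun_natCast' n)

/-- `ℤ ⊆ acl(∅)`. [folklore] -/
theorem intCast_mem_expAcl (n : ℤ) : (n : ℂ) ∈ expAcl :=
  mem_expAcl_of_definableFun_const (definableFun_intCast' n)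

/-- `acl(∅)` is closed under `exp`. -/
theorem exp_mem_expAcl {a : ℂ} (ha : a ∈ expAcl) : Complex.exp a ∈ expAcl := by
  obtain ⟨s, hs, hdef, has⟩ := ha
  refine ⟨(fun y => Complex.exp y) '' s, hs.image _, ?_, ⟨a, has, rfl⟩⟩
  have hd : (∅ : Set ℂ).Definable Language.expRing
      {v : Fin 1 → ℂ | ∃ y, y ∈ s ∧ v 0 = Complex.exp y} := by
    refine definable_setOf_exists_params (definable_setOf_and_params ?_ ?_)
    · exact definable_mem_of_definable₁ hdef (definableFun_proj_params _)
    · exact definable_setOf_eq_params (definableFun_proj_params _)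
        (definableFun_cexp (definableFun_proj_params _))
  have e : {x : Fin 1 → ℂ | x 0 ∈ (fun y => Complex.exp y) '' s} =
      {v : Fin 1 → ℂ | ∃ y, y ∈ s ∧ v 0 = Complex.exp y} := by
    ext v; simp [Set.mem_image, eq_comm]
  show Set.Definable₁ _ _ _
  unfold Set.Definable₁; rw [e]; exact hd

/-- `acl(∅)` is closed under negation. -/
theorem neg_mem_expAcl {a : ℂ} (ha : a ∈ expAcl) : -a ∈ expAcl := by
  obtain ⟨s, hs, hdef, has⟩ := ha
  refine ⟨(fun y => -y) '' s, hs.image _, ?_, ⟨a, has, rfl⟩⟩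
  have hd : (∅ : Set ℂ).Definable Language.expRing
      {v : Fin 1 → ℂ | ∃ y, y ∈ s ∧ v 0 = -y} := by
    refine definable_setOf_exists_params (definable_setOf_and_params ?_ ?_)
    · exact definable_mem_of_definable₁ hdef (definableFun_proj_params _)
    · exact definable_setOf_eq_params (definableFun_proj_params _)
        (definableFun_neg' (definableFun_proj_params _))
  have e : {x : Fin 1 → ℂ | x 0 ∈ (fun y => -y) '' s} =
      {v : Fin 1 → ℂ | ∃ y, y ∈ s ∧ v 0 = -y} := by
    ext v; simp [eq_comm, neg_eq_iff_eq_neg]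
  show Set.Definable₁ _ _ _
  unfold Set.Definable₁; rw [e]; exact hd

/-- `acl(∅)` is closed under addition. -/
theorem add_mem_expAcl {a b : ℂ} (ha : a ∈ expAcl) (hb : b ∈ expAcl) : a + b ∈ expAcl := by
  obtain ⟨s, hs, hsd, has⟩ := ha
  obtain ⟨t, ht, htd, hbt⟩ := hb
  refine ⟨Set.image2 (· + ·) s t, hs.image2 _ ht, ?_, ⟨a, has, b, hbt, rfl⟩⟩
  have hd : (∅ : Set ℂ).Definable Language.expRing
      {v : Fin 1 → ℂ | ∃ y, y ∈ s ∧ ∃ z, z ∈ t ∧ v 0 = y + z} := by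
    refine definable_setOf_exists_params (definable_setOf_and_params ?_ ?_)
    · exact definable_mem_of_definable₁ hsd (definableFun_proj_params _)
    · refine definable_setOf_exists_params (definable_setOf_and_params ?_ ?_)
      · exact definable_mem_of_definable₁ htd (definableFun_proj_params _)
      · exact definable_setOf_eq_params (definableFun_proj_params _)
          (definableFun_add' (definableFun_proj_params _) (definableFun_proj_params _))
  have e : {x : Fin 1 → ℂ | x 0 ∈ Set.image2 (· + ·) s t} =
      {v : Fin 1 → ℂ | ∃ y, y ∈ s ∧ ∃ z, z ∈ t ∧ v 0 = y + z} := by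
    ext v; simp only [Set.mem_setOf_eq, Set.mem_image2]
    constructor
    · rintro ⟨y, hy, z, hz, h⟩; exact ⟨y, hy, z, hz, h.symm⟩
    · rintro ⟨y, hy, z, hz, h⟩; exact ⟨y, hy, z, hz, h.symm⟩
  show Set.Definable₁ _ _ _
  unfold Set.Definable₁; rw [e]; exact hd

/-- `acl(∅)` is closed under multiplication. -/
theorem mul_mem_expAcl {a b : ℂ} (ha : a ∈ expAcl) (hb : b ∈ expAcl) : a * b ∈ expAcl := by
  obtain ⟨s, hs, hsd, has⟩ := ha
  obtain ⟨t, ht, htd, hbt⟩ := hb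
  refine ⟨Set.image2 (· * ·) s t, hs.image2 _ ht, ?_, ⟨a, has, b, hbt, rfl⟩⟩
  have hd : (∅ : Set ℂ).Definable Language.expRing
      {v : Fin 1 → ℂ | ∃ y, y ∈ s ∧ ∃ z, z ∈ t ∧ v 0 = y * z} := by
    refine definable_setOf_exists_params (definable_setOf_and_params ?_ ?_)
    · exact definable_mem_of_definable₁ hsd (definableFun_proj_params _)
    · refine definable_setOf_exists_params (definable_setOf_and_params ?_ ?_)
      · exact definable_mem_of_definable₁ htd (definableFun_proj_params _)
      · exact definable_setOf_eq_params (definableFun_proj_params _)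
          (definableFun_mul' (definableFun_proj_params _) (definableFun_proj_params _))
  have e : {x : Fin 1 → ℂ | x 0 ∈ Set.image2 (· * ·) s t} =
      {v : Fin 1 → ℂ | ∃ y, y ∈ s ∧ ∃ z, z ∈ t ∧ v 0 = y * z} := by
    ext v; simp only [Set.mem_setOf_eq, Set.mem_image2]
    constructor
    · rintro ⟨y, hy, z, hz, h⟩; exact ⟨y, hy, z, hz, h.symm⟩
    · rintro ⟨y, hy, z, hz, h⟩; exact ⟨y, hy, z, hz, h.symm⟩
  show Set.Definable₁ _ _ _
  unfold Set.Definable₁; rw [e]; exact hd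

/-- `acl(∅)` is closed under inverses. -/
theorem inv_mem_expAcl {a : ℂ} (ha : a ∈ expAcl) : a⁻¹ ∈ expAcl := by
  rcases eq_or_ne a 0 with rfl | ha0
  · simpa using natCast_mem_expAcl 0
  obtain ⟨s, hs, hsd, has⟩ := ha
  refine ⟨{x | ∃ y, y ∈ s ∧ x * y = 1}, ?_, ?_, ⟨a, has, inv_mul_cancel₀ ha0⟩⟩
  · refine (hs.image (fun y => y⁻¹)).subset ?_
    rintro x ⟨y, hy, hxy⟩
    exact ⟨y, hy, (eq_inv_of_mul_eq_one_left hxy).symm⟩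
  · have hd : (∅ : Set ℂ).Definable Language.expRing
        {v : Fin 1 → ℂ | ∃ y, y ∈ s ∧ v 0 * y = 1} := by
      refine definable_setOf_exists_params (definable_setOf_and_params ?_ ?_)
      · exact definable_mem_of_definable₁ hsd (definableFun_proj_params _)
      · exact definable_setOf_eq_params
          (definableFun_mul' (definableFun_proj_params _) (definableFun_proj_params _))
          definableFun_one'
    exact hd

/-- `acl^{ℂ_exp}(∅)` as a subfield of `ℂ`. -/
def expAclSubfield : Subfield ℂ where
  carrier := expAcl
  mul_mem' := mul_mem_expAcl
  one_mem' := by simpa using natCast_mem_expAcl 1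
  add_mem' := add_mem_expAcl
  zero_mem' := by simpa using natCast_mem_expAcl 0
  neg_mem' := neg_mem_expAcl
  inv_mem' := fun _ => inv_mem_expAcl

/-- `acl^{ℂ_exp}(∅)` as an intermediate field of `ℂ/ℚ`. -/
def expAclField : IntermediateField ℚ ℂ :=
  expAclSubfield.toIntermediateField fun q => by
    show ((q : ℚ) : ℂ) ∈ expAclSubfield
    rw [Rat.cast_def]
    exact div_mem (intCast_mem_expAcl q.num) (natCast_mem_expAcl q.den)

/-- Membership in `expAclField` is membership in `acl(∅)`. [folklore] -/
@[simp] theorem mem_expAclField {x : ℂ} : x ∈ expAclField ↔ x ∈ expAcl := Iff.rfl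

/-- Polynomial maps with integer coefficients (any finite set of variables) are `∅`-definable. -/
theorem definableFun_mvPolynomial_aeval' {σ : Type*} (Q : MvPolynomial σ ℤ) :
    (∅ : Set ℂ).DefinableFun Language.expRing (fun x : σ → ℂ => MvPolynomial.aeval x Q) := by
  induction Q using MvPolynomial.induction_on with
  | C a => simpa using definableFun_intCast' (A := (∅ : Set ℂ)) (α := σ) a
  | add p q hp hq => simpa using definableFun_add' hp hq
  | mul_X p i hp => simpa using definableFun_mul' hp (definableFun_proj_params i)

/-- **`acl(∅)` is relatively algebraically closed in `ℂ`**: a root of a non-zero polynomial whose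
coefficients lie in finite `∅`-definable sets lies in the finite `∅`-definable set of roots of
all non-degenerate polynomials with coefficients from those sets. -/
theorem expAcl_relAlgClosed : ∀ w : ℂ, IsAlgebraic expAclField w → w ∈ expAcl := by
  rintro w ⟨p, hp0, hpw⟩
  set d := p.natDegree with hd
  have hc : ∀ j : Fin (d + 1), ((p.coeff j : expAclField) : ℂ) ∈ expAcl := fun j => (p.coeff j).2
  choose s hs hsd hcs using hc
  -- the candidate finite definable set
  let S : Set ℂ := {x | ∃ y : Fin (d + 1) → ℂ, (∀ j, y j ∈ s j) ∧ y (Fin.last d) ≠ 0 ∧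
    ∑ j : Fin (d + 1), y j * x ^ (j : ℕ) = 0}
  -- the polynomial attached to a coefficient vector
  let P : (Fin (d + 1) → ℂ) → Polynomial ℂ := fun y =>
    ∑ j : Fin (d + 1), Polynomial.monomial (j : ℕ) (y j)
  have hPeval : ∀ y x, (P y).eval x = ∑ j : Fin (d + 1), y j * x ^ (j : ℕ) := by
    intro y x
    simp [P, Polynomial.eval_finsetSum, Polynomial.eval_monomial]
  have hPcoeff : ∀ y, (P y).coeff d = y (Fin.last d) := by
    intro y
    simp only [P, Polynomial.finsetSum_coeff, Polynomial.coeff_monomial]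
    rw [Finset.sum_eq_single (Fin.last d)]
    · simp
    · intro j _ hj
      have : (j : ℕ) ≠ d := fun h => hj (Fin.ext (by simpa using h))
      simp [this]
    · simp
  refine ⟨S, ?_, ?_, ?_⟩
  · -- finiteness
    have hsub : S ⊆ ⋃ y ∈ {f : Fin (d + 1) → ℂ | ∀ j, f j ∈ s j}, {x | P y ≠ 0 ∧ (P y).IsRoot x} := by
      rintro x ⟨y, hy, hyd, hsum⟩
      refine Set.mem_biUnion hy ⟨fun h0 => hyd ?_, ?_⟩
      · have := congrArg (fun q : Polynomial ℂ => q.coeff d) h0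
        simpa [hPcoeff] using this
      · show (P y).eval x = 0
        rw [hPeval]; exact hsum
    refine Set.Finite.subset ?_ hsub
    refine Set.Finite.biUnion (Set.Finite.pi' hs) fun y _ => ?_
    by_cases h : P y = 0
    · have : {x : ℂ | P y ≠ 0 ∧ (P y).IsRoot x} = ∅ := by ext x; simp [h]
      rw [this]; exact Set.finite_empty
    · exact (Polynomial.finite_setOf_isRoot h).subset fun x hx => hx.2
  · -- definability
    let T : Set (Fin 1 ⊕ Fin (d + 1) → ℂ) := {w | (∀ j, w (Sum.inr j) ∈ s j) ∧
      ¬ w (Sum.inr (Fin.last d)) = 0 ∧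
        ∑ j : Fin (d + 1), w (Sum.inr j) * w (Sum.inl 0) ^ (j : ℕ) = 0}
    have hT : (∅ : Set ℂ).Definable Language.expRing T := by
      refine definable_setOf_and_params ?_ (definable_setOf_and_params ?_ ?_)
      · have : {w : Fin 1 ⊕ Fin (d + 1) → ℂ | ∀ j, w (Sum.inr j) ∈ s j} =
            ⋂ j, {w | w (Sum.inr j) ∈ s j} := by ext w; simp
        rw [this]
        exact Set.definable_iInter_of_finite fun j =>
          definable_mem_of_definable₁ (hsd j) (definableFun_proj_params _)
      · exact definable_setOf_not_params
          (definable_setOf_eq_params (definableFun_proj_params _) definableFun_zero')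
      · let Q : MvPolynomial (Fin 1 ⊕ Fin (d + 1)) ℤ :=
          ∑ j : Fin (d + 1), MvPolynomial.X (Sum.inr j) * MvPolynomial.X (Sum.inl 0) ^ (j : ℕ)
        have hQ : (fun w : Fin 1 ⊕ Fin (d + 1) → ℂ =>
            ∑ j : Fin (d + 1), w (Sum.inr j) * w (Sum.inl 0) ^ (j : ℕ)) =
            fun w => MvPolynomial.aeval w Q := by
          funext w; simp [Q, map_sum]
        have hf := definableFun_mvPolynomial_aeval' Q
        rw [← hQ] at hf
        exact definable_setOf_eq_params hf definableFun_zero'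
    have h := hT.exists_of_finite
    have e : {x : Fin 1 → ℂ | x 0 ∈ S} = {v : Fin 1 → ℂ | ∃ u : Fin (d + 1) → ℂ, Sum.elim v u ∈ T} := by
      ext v; simp [S, T]
    show Set.Definable₁ _ _ _
    unfold Set.Definable₁; rw [e]; exact h
  · -- membership of `w`
    refine ⟨fun j => ((p.coeff j : expAclField) : ℂ), hcs, ?_, ?_⟩
    · have hlead : p.coeff d ≠ 0 := by
        rw [hd]; exact Polynomial.leadingCoeff_ne_zero.2 hp0
      intro h
      apply hlead
      have h' : ((p.coeff (Fin.last d : ℕ) : expAclField) : ℂ) = 0 := h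
      rw [Fin.val_last] at h'
      exact_mod_cast h'
    · have h1 := hpw
      rw [Polynomial.aeval_eq_sum_range, ← hd] at h1
      rw [← h1, ← Fin.sum_univ_eq_sum_range (fun i => p.coeff i • w ^ i) (d + 1)]
      refine Finset.sum_congr rfl fun j _ => ?_
      rw [Algebra.smul_def]
      rfl

/-- `acl(∅)` is a member of the family defining the core. -/
theorem expAclField_mem_coreFamily : expAclField ∈ coreFamily :=
  ⟨two_pi_I_mem_expAcl, fun _ hw => exp_mem_expAcl hw, expAcl_relAlgClosed⟩

/-- **Tightness of (A): `C_EA ⊆ acl^{ℂ_exp}(∅)`** — the route's support item 0972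
(`RigidCore.LogFreeCoreSubsetAcl`), proved. -/
theorem logFreeCore_subset_expAcl : (logFreeCore : Set ℂ) ⊆ expAcl := fun _ ha =>
  logFreeCore_le_of_mem expAclField_mem_coreFamily ha

/-- Hence the crux (A) is equivalent to EQUALITY `acl^{ℂ_exp}(∅) = C_EA`: the bound `C_EA` cannot
be improved. -/
theorem aclSubsetLogFreeCore_iff_eq :
    Summit.Schanuel.Schanuel.Theses.RigidCore.AclSubsetLogFreeCore ↔
      expAcl = (logFreeCore : Set ℂ) :=
  ⟨fun h => Set.Subset.antisymm h logFreeCore_subset_expAcl, fun h => h.le⟩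

end Summit.Schanuel.Schanuel.Theorems.AclSubsetLogFreeCore.Negative
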